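import Mathlib
import HarnessLib
import HarnessLib.Audit
import Summits.PneNP.Statement
import Literature.Computability.Complexity.Classes
import Literature.Computability.Complexity.BoolEncodings
import Literature.Computability.Complexity.PolyHierarchy
import Literature.Computability.Complexity.Nondeterministic
import Literature.Computability.Complexity.ClayProblem
import Literature.Computability.Complexity.ClayProblemProofs
import Literature.Computability.Complexity.NondeterministicProofs
import Literature.Computability.Complexity.NPClosureProofs
import HarnessLib.Audit.Status.Attr

/-!
Route: StraightLineSign

DORMANT since 2026-08-24T07:12:54Z (reconciler: no traction for 6.6 d (last activity item-evidence-added at 2026-08-17T16:50:05Z); parked, not closed — `ledger route dormant route-PneNP-StraightLineSign --off` to reactivate) — unstaffed, not closed; items shared with open routes are served there. `ledger route dormant <id> --off` reactivates.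

# Route StraightLineSign — P ≠ NP if the sign of a straight-line program is PH-easy but not P-easy
(PosSLP ∈ PH ∖ P)

X = B ∧ A ("it suffices to show"), a factorisation of P ≠ NP through ONE numeric problem of unknown
position, PosSLP
(Allender–Bürgisser–Kjeldgaard-Pedersen–Miltersen: given a division-free straight-line program over
{1; +, −, ×}, is the
integer it computes positive?). B (PosSLPInPH): PosSLP lies in the polynomial hierarchy — the
upper-bound question ABKM leave
open ("better upper bounds for PosSLP", AllenderEtAl2009 §1; best known PH^{PP^{PP}} ⊆ CH, Thm
1.4/3.2) in the form Jindal–Saranurak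
reach conditionally (τ₊ = τ^{O(1)} ⇒ PosSLP ∈ Σ₂ᵖ, arXiv:1212.2549 Fact 2). A (PosSLPNotInP): PosSLP
is not decidable in polynomial
time — the hardness question printed in Bürgisser–Jindal (arXiv:2307.08008 §6 (1), p. 13) and
Bläser–Dörfler–Jindal (arXiv:2403.00115
§5 (4), p. 13), true under NP ⊄ BPP plus the constructive radical conjecture (BJ23 Thm 1.2). If P =
NP then PH = P (Stockmeyer), so B
puts PosSLP in P, contradicting A. No idea card is realised (literature-born, lens
open-question-harvest).
Lean: `(let step : List ℤ → ℕ × ℕ × ℕ → List ℤ := fun vs ins => vs ++ [if ins.1 % 3 = 0 then vs.getD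
ins.2.1 0 + vs.getD ins.2.2 0 else if ins.1 % 3 = 1 then vs.getD ins.2.1 0 - vs.getD ins.2.2 0 else
vs.getD ins.2.1 0 * vs.getD ins.2.2 0]; let value : List (ℕ × ℕ × ℕ) → ℤ := fun prog => ((prog.foldl
step [1]).getLast?).getD 1; Literature.Computability.Complexity.encodingListNatBool.toLanguage {l :
List ℕ | ∃ prog : List (ℕ × ℕ × ℕ), l = prog.flatMap (fun ins => [ins.1, ins.2.1, ins.2.2]) ∧ 0 <
value prog} ∈ Literature.Computability.Complexity.PH ∧
Literature.Computability.Complexity.encodingListNatBool.toLanguage {l : List ℕ | ∃ prog : List (ℕ ×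
ℕ × ℕ), l = prog.flatMap (fun ins => [ins.1, ins.2.1, ins.2.2]) ∧ 0 < value prog} ∉
Literature.Computability.Complexity.Classes.P)`

## Assembly
Pure logic plus the Meyer–Stockmeyer collapse, sorry-free (Sketch.lean `assembly_holds`,
bc/GlueSim.lean `closes`, rc 0): assume ¬PneNP;
the proved bridges P_bool_eq_holds / NP_bool_eq_holds / P_subset_NP_holds give Classes.P = NP;
induction on k with SigmaP_succ, PiP_eq_co,
co_P_holds and SigmaP_one_holds gives SigmaP k = P for all k, hence PH ⊆ P; PosSLPInPH then puts
PosSLP in P, contradicting PosSLPNotInP.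
The deciding theorem `closes (hB : PosSLPInPH) (hA : PosSLPNotInP) : PneNP` in glue.lean is exactly
this; both binders are load-bearing.

Rationale: WHY THIS LINE. PosSLP is suspended between the two halves of the summit: it is NP-hard under
randomized reductions assuming the constructive univariate
radical conjecture (Bürgisser–Jindal SODA 2024 = arXiv:2307.08008, Thm 1.2: RadConj ∧ PosSLP ∈ BPP ⇒
NP ⊆ BPP), it captures efficient
real-number computation exactly (P^PosSLP = BP(P⁰_ℝ), AllenderEtAl2009 Prop 1.1; GTNC ≡ᵀ PosSLP,
Prop 1.3), and yet its only upper bound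
is the counting hierarchy (Thm 1.4), with a printed mechanism that would drop it into Σ₂ᵖ
(Jindal–Saranurak 2012, Fact 2: if
subtraction saves at most a polynomial in computing positive integers by SLPs, guess the monotone
program and verify equality of
values by Schönhage's coRP identity test). The squeeze S ⟸ (PosSLP ∈ PH) ∧ (PosSLP ∉ P) is therefore
non-degenerate: B is not a
collapse consequence (P = NP collapses PH, not CH), A is not known to imply S, and the conjunction
decides S by two lines of logic
(glue certified). Imported areas: numerical analysis / Blum–Shub–Smale real complexity (ABKM),
arithmetic complexity of integers τ(n)
(de Melo–Svaiter, Moreira, the Shub–Smale τ-circle already vendored under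
Literature.Computability.AlgebraicComplexity.TauConjecture),
additive number theory (four-square certificates of positivity, Bläser–Dörfler–Jindal
arXiv:2403.00115), algebraic complexity
(radical/factor conjectures, DegSLP). No listed PneNP route, card or negative touches PosSLP, τ/τ₊
or BSS Boolean parts; the nearest
shape is PermanentDescent (squeeze through a problem above NP), whose transfer piece is a bare
collapse implication for a #P-complete
function — here the transfer piece is a printed MEMBERSHIP question with concrete certificate
mechanisms, and the intermediate object is
not complete for any counting class (no unconditional hardness of PosSLP is known at all, BDJ24 p.
3).

RANKED CRUXES. #2 PosSLPInPH (crux) — PosSLP ∈ PH — the language of `encodingListNatBool`-codes of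
flattened programs [op₁,j₁,k₁,op₂,…] (value list starts [1]; instruction (op,j,k) appends v_j ∘ v_k
with ∘ = +,−,× for op % 3 = 0,1,2; out-of-range reads are 0; value = last entry) with positive value
lies in the polynomial hierarchy (ABKM's upper-bound question, in the form Jindal–Saranurak's
monotone-certificate mechanism would give). [difficulty: open-problem] (why it might fail: PosSLP's
cousins are #P-hard (BitSLP, AllenderEtAl2009 Prop 2.4; counting real roots, arXiv:2307.08008 Thm
1.4): if PosSLP is PP- or C₌P-hard (even under RadConj) then B forces PH to collapse; JS12
themselves suspect τ₊ ≠ τ^{O(1)} (arXiv:1212.2549 §4 p. 10).) [AllenderEtAl2009, arXiv:1212.2549,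
arXiv:2307.08008, arXiv:2403.00115, Stockmeyer1976]
#3 PosSLPNotInP (crux) — PosSLP ∉ P — the same language is decided by no deterministic
polynomial-time Turing machine ("can we prove unconditional hardness results for PosSLP?",
Bläser–Dörfler–Jindal §5 (4), p. 13; "it remains intriguing to prove the unconditional NP-hardness
of PosSLP", Bürgisser–Jindal §6, p. 13; "providing any sort of hardness theorem", ABKM §1).
[difficulty: open-problem] (why it might fail: PosSLP ∈ CH ⊆ PSPACE, so any proof also separates P
from PH^{PP^{PP}} (no technique); its best-understood special cases may be EASY: sum-of-square-roots
is conjectured in P (Malajovich), succinct-product inequality is in P under Lang–Waldschmidt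
(arXiv:2307.08008 p. 4).) [arXiv:2307.08008, arXiv:2403.00115, AllenderEtAl2009,
doi:10.1137/1.9781611977912.75]
#9 MonotoneCatchUp (support) — Jindal–Saranurak's printed open problem (arXiv:1212.2549 §1.2 and §4,
p. 10; Bürgisser–Jindal p. 3): subtraction saves at most a polynomial — for every positive integer
n, τ₊(n) ≤ c·τ(n)^c + c, where τ(n) is the length of a shortest program computing n and τ₊(n) that
of a shortest monotone program (no subtraction, in-range operands: an addition–multiplication
chain). The first sufficient mechanism for PosSLPInPH; known separation is one step (τ₊(2^{2^k}−1) −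
τ(2^{2^k}−1) ≥ 1, JS12 Thm). [difficulty: open-problem] [arXiv:1212.2549, arXiv:2307.08008]
#9 CatchUpGivesPH (support) — glue of the foreseen split (Jindal–Saranurak 2012, Fact 2, p. 3):
MonotoneCatchUp → PosSLPInPH — guess a polynomial-size monotone program, verify that the difference
program computes 0 by Schönhage's EquSLP ∈ coRP test (AllenderEtAl2009 §2, Prop 2.2), use that a
monotone in-range program has positive value, and place ∃ᵖ·coRP ⊆ ∃ᵖ·Π₂ᵖ = Σ₃ᵖ ⊆ PH (tree:
BPP_subset_PiP_two, SigmaP_succ, SigmaP_subset_PH; composition checked in bc/PosSLPInPH_birth.lean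
`PosSLPInPH_of`). [difficulty: M] [arXiv:1212.2549, AllenderEtAl2009]

TWO-LAYER PLAN. Foreseen, not filed: PosSLPInPH ⇐ MonotoneCatchUp → CatchUpGivesPH → PosSLPInPH (the
JS12 split; both children typed above as supports;
birth skeleton bc/PosSLPInPH_birth.lean with stubs stub_monotoneCatchUp / stub_equSLPInCoRP /
stub_monotoneCertificate); alternative child
FourSquareCertificates (Bläser–Dörfler–Jindal's Lagrange reformulation: every positive SLP-integer N
is a²+b²+c²+d² with a,b,c,d of
SLP-complexity poly(τ(N)) ⇒ PosSLP ∈ ∃ᵖ·coRP), and the special-case ladder SSR ∈ PH →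
succinct-product inequality ∈ PH → bounded-depth
PosSLP ∈ PH. PosSLPNotInP ⇐ DegSLPKarpReducesToPosSLP (AllenderEtAl2009 Prop 2.3, printed theorem) →
DegSLPNotInP → PosSLPNotInP (the
algebraic rung: degree = cancellation of leading coefficients of an SLP-computed polynomial; birth
skeleton bc/PosSLPNotInP_birth.lean);
alternative child through the BSS reading P^PosSLP = BP(P⁰_ℝ) (Prop 1.1) once real machines are
typed. k ≤ 3 each, depth 1.

KILL CRITERIA. A kernel refutation of PosSLPInPH (PosSLP ∉ PH) or of PosSLPNotInP (a polynomial-time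
algorithm for PosSLP — which by ABKM Prop 1.3
would make the generic task of numerical computation polynomial-time) closes the route outright
(close --reason refuted:<Decl>); the
latter would be a major theorem on its own. A refutation of the support MonotoneCatchUp (an explicit
family with τ₊ super-polynomial in
τ) kills only the JS12 mechanism: pivot CatchUpGivesPH to FourSquareCertificates or to the
special-case ladder. Evidence that PosSLP is
PP-, C₌P- or #P-hard (even conditionally on RadConj, in Bürgisser–Jindal's framework) makes
PosSLPInPH imply a PH collapse: retire the
route as exhausted with that census. NP ≠ coNP or NP ⊄ BPP proved elsewhere moots it (PneNP follows
directly); P ≠ PH^{PP^{PP}} proved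
elsewhere does NOT moot it but removes A's difficulty floor objection.

NOT DECOMPOSED YET. The certificate mechanism for B is deliberately not chosen at open (monotone
programs vs four squares vs approximation of log|N|); the
coRP identity test (Schönhage) and the exact level (Σ₂ᵖ vs Σ₃ᵖ) are bookkeeping inside
CatchUpGivesPH; the reduction DegSLP ≤ᵖₘ PosSLP
(evaluation at 2^(2^(n²))) and the BSS characterisation are layer-2 children of A; the
radical-conjecture reduction of Bürgisser–Jindal
(3SAT → UniqueSAT → real-root counting → sign) is recorded as the reason A is believed, not as an
item (it derives A FROM NP ⊄ BPP and
cannot be used toward S); encoding conventions (start constant 1 only, opcode mod 3, out-of-range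
operands read 0) are fixed and are
polynomially equivalent to ABKM's/JS12's (τ changes by O(1), code length by a log factor).

CHEAPEST FALSIFIER. For the mechanism: an exhaustive τ₊-versus-τ search (one kit job: all n ≤ 10⁶ by
BFS over value sets, plus the structured families
2^{2^k} ± 1, Π Fermat numbers, Lucas/Chebyshev values U_k(2^{2^j}), resultant-type integers) looking
for a family with τ₊(n) − τ(n)
unbounded — Jindal–Saranurak know only a gap of ONE step (arXiv:1212.2549 Thm, §4); not run this
session (left to the first refuter;
either outcome answers a printed question). For the route: the lookup "is PosSLP known PP- /#P-hard?"
— run: no (AllenderEtAl2009 §1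
"any sort of hardness theorem" open; arXiv:2403.00115 p. 3 "no unconditional non-trivial hardness
results are known for PosSLP";
arXiv:2307.08008 gives only conditional NP-hardness); and "is PosSLP ∈ PH known?" — run: no
(arXiv:2403.00115 p. 3: CH "is still the
best-known upper bound"; `lit citing arxiv:2307.08008`: 5 citers, none an upper bound;
arXiv:2603.29427 p. 9 poses only PosSLP ∈ ∃ℝ as
an exercise); doi:10.3233/com-220407 (Allender–Balaji–Datta–Pratap 2023, bit-complexity of SLPs) is
paywalled — acq-06655 filed.

NUMBERS. τ(n) ≥ log₂log₂ n always and τ(n) ≤ 2 log₂ n (binary method); τ(n) ≥ log n / log log n for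
almost all n (de Melo–Svaiter 1996,
Moreira 1997; JS12 §3: τ₊(n) = Θ(τ(n)) for almost all n); the only proven power of subtraction:
τ₊(2^{2^k} − 1) − τ(2^{2^k} − 1) ≥ 1
with τ₊(2^{2^k} − 1) ≤ 2k (arXiv:1212.2549 §4). Upper bound: PosSLP ∈ PH^{PP^{PP}} ⊆
P^{PP^{PP^{PP}}} (AllenderEtAl2009 Thm 3.2/1.4);
PosSLP ∈ ∃ℝ (folklore, arXiv:2603.29427 p. 9). Hardness: RadConj ∧ PosSLP ∈ BPP ⇒ NP ⊆ BPP
(arXiv:2307.08008 Thm 1.2); ACIT ≤ᵖₘ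
DegSLP ≤ᵖₘ PosSLP ≤ᵖₘ BitSLP, BitSLP #P-hard (AllenderEtAl2009 Props 2.2–2.4); CountRealRoots
#P-hard (arXiv:2307.08008 Thm 1.4);
PosPolySLP coNP-hard (arXiv:2403.00115 Thm 1.8); EquSLP ∈ coRP (Schönhage 1979). Items at open: 5 (2
crux, 2 support, 1 assembly).

DEFINITION REQUESTS. None needed to type the items (everything is inlined over encodingListNatBool,
Classes.P, PH). Wanted later, for provers' comfort:
a Literature definition `Literature.Computability.AlgebraicComplexity.posSLP` (the language above,
with `slpValue`) tying τ to the
vendored `constantFreeComplexity`; cite facts: AllenderEtAl2009 Thm 1.4 (PosSLP ∈ CH — needs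
PP-oracle towers, the tree has PP and
PRelClass), Prop 2.3 (DegSLP ≤ᵖₘ PosSLP), Bürgisser–Jindal Thm 1.2 (needs the constructive radical
conjecture as an OPEN def), and
Jindal–Saranurak Fact 2. Literature want: doi:10.3233/com-220407 (acq-06655).

Novelty: Searches (2026-08-17): `grep PosSLP|straight-line|BSS|Blum` over Summits/PneNP/PneNP/Theses (49
files), Ideas (66 + 71 closed): 0 relevant hits (NoTardosTropics uses Koiran's ADDITIVE real
machines for mean-payoff games, a different object and direction); `lean search PosSLP` (tree +
Mathlib): 0; `lit galaxy search "PosSLP" --star all` (27 rows: ABKM, BDJ24, ESY recursive Markov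
chains, Ouaknine–Worrell positivity, integer linear-exponential programs 2025 — all users of
PosSLP-hardness, none an upper bound); `lit galaxy search "hardness of PosSLP" --star all` (1 row);
`lit search --source zbmath "On the hardness of PosSLP"` (→ doi:10.1137/1.9781611977912.75 =
arXiv:2307.08008); `lit citing arxiv:2307.08008` (5: arXiv:2603.29427, arXiv:2502.09279,
arXiv:2403.00115, 2 corpus ids); `lit citing arxiv:1212.2549` (4: doi:10.3233/com-220407, BJ23,
addition–multiplication chains 2018, ABD MFCS 2014); page-level reads of arXiv:2307.08008 pp 2–4,
12–13; arXiv:2403.00115 pp 1–4, 13; arXiv:1212.2549 pp 2–4, 10; AllenderEtAl2009 (conference text)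
pp 1–13; arXiv:2203.14379 pp 2–7, 23 (rejected CJSW refuter line); lens corpus (frontier 60 rows,
reads.jsonl 5 papers, questions.tsv 400 rows) and literature refresh (new.md 45, questions.tsv 987,
nearmiss.md).
Nearest prior art found: arXiv:1212.2549 (Jindal–Saranurak: the implication τ₊ = τ^{O(1)} ⇒ PosSLP ∈
Σ₂ᵖ and the open problem); arXiv:2307.08008 (Bürgisser–Jindal: conditional NP-hardness, open
questions §6); AllenderEtAl2009 (PosSLP, CH  [refs: 10.1137/1.9781611977912.75, 10.3233/com-220407, 2307.08008, 2603.29427, 2502.09279, 2403.00115, 1212.2549, 2203.14379, doi:10.1137/1.9781611977912.75, arxiv:2307.08008, arxiv:1212.2549, doi:10.3233/com-220407, AllenderEtAl2009]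

Barriers (technique_class: collapse-squeeze, CH-membership, monotone-slp, bss-transfer): - technique_class: collapse-squeeze, CH-membership, monotone-slp, bss-transfer
- Literature.Barriers.PneNP.Relativization: the glue (P = NP ⇒ PH = P ⇒ PosSLP ∈ P) relativizes and
is meant to; all non-relativizing content sits in PosSLPNotInP, and there it is FORCED: relative to
the BGS/PSPACE-complete oracle O, PosSLP ∈ PSPACE ⊆ P^O, so no oracle-robust argument proves A — it
does not evade by technique; the bet is problem-specific structure (ABKM Prop 1.1 P^PosSLP =
BP(P⁰_ℝ): semialgebraic/degree arguments over ℝ; DegSLP's coefficient cancellation), which is not a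
statement about oracle machines.
- Literature.Barriers.PneNP.RelativizationNarrow: PosSLP is P-hard and dense, not sparse/tally; the
sparse/tally refinements neither block nor help this line.
- Literature.Barriers.PneNP.BoundedRelativization: applies verbatim to A (the collapsing oracle may
be taken PSPACE-complete and PosSLP ∈ PSPACE): any proof of PosSLPNotInP is non-PSPACE-relativizing
by necessity — it does not evade; the bet is as above. B (an upper bound) is outside the barrier's
scope.
- Literature.Barriers.PneNP.BoundedRelativizationNarrow: records as OPEN whether a counting class
(PP, P^{#P}, CH) carries a collapsing oracle — exactly the regime of PosSLP ∈ CH: if CH carries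
none, a CH-relativizing proof of A is not excluded by the catalogue.
- Literature.Barriers.PneNP.Algebrization: same shape as relativization for A (PosSLP ∈ P^A for the
PSPACE-complete A of the algebrizing collapse pair) — it does not e

History (route lifecycle, newest last):
- 2026-08-17T02:26:34Z · rev 1: dropped MonotoneCatchUp, CatchUpGivesPH — post-open hygiene: the gate auto-kinded the conjecture-grade support MonotoneCatchUp (JS12 open problem) as a rank-9 crux outside the cone of `closes` (decorati (planner-plan-lens3-PneNP-oqh-g2-0)
- 2026-08-24T07:12:54Z · DORMANT — reconciler: no traction for 6.6 d (last activity item-evidence-added at 2026-08-17T16:50:05Z); parked, not closed — `ledger route dormant route-PneNP-StraightLi (operator:999:4124361)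

sub-problem: PneNP · status: dormant · opened planner-plan-lens3-PneNP-oqh-g2-0 2026-08-17T02:25:20Z · rev 1 · ledger route-PneNP-StraightLineSign
GENERATED by the gate from the ledger (D-0016/17). Provers cite these decls: `theorem foo : Summit.PneNP.PneNP.Theses.StraightLineSign.<Decl> := …` in Summits/PneNP/PneNP/Theorems/<Name>.lean.
-/

namespace Summit.PneNP.PneNP.Theses.StraightLineSign

open scoped BigOperators Topology Manifold Classical MeasureTheory ProbabilityTheory Matrix InnerProductSpace ComplexConjugate ContinuousMap
open Filter Set Function TopologicalSpace MeasureTheory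

attribute [summit_statement] _root_.PneNP

open Literature.PNP

/-- item stmt-PneNP-18282 · crux · rank 2 · open · by planner
why it might fail: PosSLP's cousins are #P-hard (BitSLP, AllenderEtAl2009 Prop 2.4; counting real roots, arXiv:2307.08008 Thm 1.4): if PosSLP is PP- or C₌P-hard (even under RadConj) then B forces PH to collapse; JS12 themselves suspect τ₊ ≠ τ^{O(1)} (arXiv:1212.2549 §4 p. 10).
sources: AllenderEtAl2009, arXiv:1212.2549, arXiv:2307.08008, arXiv:2403.00115, Stockmeyer1976
[crux] PosSLP ∈ PH — the language of `encodingListNatBool`-codes of flattened programs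
[op₁,j₁,k₁,op₂,…] (value list starts [1]; instruction (op,j,k) appends v_j ∘ v_k with ∘ = +,−,× for
op % 3 = 0,1,2; out-of-range reads are 0; value = last entry) with positive value lies in the
polynomial hierarchy (ABKM's upper-bound question, in the form Jindal–Saranurak's
monotone-certificate mechanism would give). [difficulty: open-problem] -/
@[route_item "route-PneNP-StraightLineSign", crux]
def PosSLPInPH : Prop :=
  (let step : List ℤ → ℕ × ℕ × ℕ → List ℤ := fun vs ins => vs ++ [if ins.1 % 3 = 0 then vs.getD ins.2.1 0 + vs.getD ins.2.2 0 else if ins.1 % 3 = 1 then vs.getD ins.2.1 0 - vs.getD ins.2.2 0 else vs.getD ins.2.1 0 * vs.getD ins.2.2 0]; let value : List (ℕ × ℕ × ℕ) → ℤ := fun prog => ((prog.foldl step [1]).getLast?).getD 1; Literature.Computability.Complexity.encodingListNatBool.toLanguage {l : List ℕ | ∃ prog : List (ℕ × ℕ × ℕ), l = prog.flatMap (fun ins => [ins.1, ins.2.1, ins.2.2]) ∧ 0 < value prog} ∈ Literature.Computability.Complexity.PH)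

/-- item stmt-PneNP-18283 · crux · rank 3 · open · by planner
why it might fail: PosSLP ∈ CH ⊆ PSPACE, so any proof also separates P from PH^{PP^{PP}} (no technique); its best-understood special cases may be EASY: sum-of-square-roots is conjectured in P (Malajovich), succinct-product inequality is in P under Lang–Waldschmidt (arXiv:2307.08008 p. 4).
sources: arXiv:2307.08008, arXiv:2403.00115, AllenderEtAl2009, doi:10.1137/1.9781611977912.75
[crux] PosSLP ∉ P — the same language is decided by no deterministic polynomial-time Turing machine
("can we prove unconditional hardness results for PosSLP?", Bläser–Dörfler–Jindal §5 (4), p. 13; "it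
remains intriguing to prove the unconditional NP-hardness of PosSLP", Bürgisser–Jindal §6, p. 13;
"providing any sort of hardness theorem", ABKM §1). [difficulty: open-problem] -/
@[route_item "route-PneNP-StraightLineSign", crux]
def PosSLPNotInP : Prop :=
  (let step : List ℤ → ℕ × ℕ × ℕ → List ℤ := fun vs ins => vs ++ [if ins.1 % 3 = 0 then vs.getD ins.2.1 0 + vs.getD ins.2.2 0 else if ins.1 % 3 = 1 then vs.getD ins.2.1 0 - vs.getD ins.2.2 0 else vs.getD ins.2.1 0 * vs.getD ins.2.2 0]; let value : List (ℕ × ℕ × ℕ) → ℤ := fun prog => ((prog.foldl step [1]).getLast?).getD 1; Literature.Computability.Complexity.encodingListNatBool.toLanguage {l : List ℕ | ∃ prog : List (ℕ × ℕ × ℕ), l = prog.flatMap (fun ins => [ins.1, ins.2.1, ins.2.2]) ∧ 0 < value prog} ∉ Literature.Computability.Complexity.Classes.P)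

/-- item stmt-PneNP-18286 · assembly · rank 1 · open · by planner
sources: Stockmeyer1976, AroraBarakCC2009
[assembly] PosSLPInPH → PosSLPNotInP → PneNP (by contradiction through PH = P under P = NP). -/
@[route_item "route-PneNP-StraightLineSign"]
def Assembly : Prop :=
  PosSLPInPH → PosSLPNotInP → _root_.PneNP

/-! D-0027 §2.1 — DECIDING THEOREM (planner-authored via `route open/edit --closes-file`; by planner-plan-lens3-PneNP-oqh-g2-0 2026-08-17T02:25:20Z):
its hypotheses are this route's items and its conclusion the sub-problem Statement (glue_lint), and it elaborates with this file. -/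

@[closes "route-PneNP-StraightLineSign"] theorem closes (hB : PosSLPInPH) (hA : PosSLPNotInP) : _root_.PneNP := by
  by_contra h
  have hPeq : Literature.Computability.Complexity.PNPWave0.P Bool =
      Literature.Computability.Complexity.Classes.P :=
    Literature.Computability.Complexity.P_bool_eq_holds
  have hNeq : Literature.Computability.Complexity.PNPWave0.NP Bool =
      Literature.Computability.Complexity.Nondeterministic.NP :=
    Literature.Computability.Complexity.NP_bool_eq_holds
  have hsub : Literature.Computability.Complexity.Nondeterministic.NP ⊆
      Literature.Computability.Complexity.Classes.P := by
    intro L hL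
    by_contra hL'
    exact h ⟨L, hNeq ▸ hL, hPeq ▸ hL'⟩
  have heq : Literature.Computability.Complexity.Classes.P =
      Literature.Computability.Complexity.Nondeterministic.NP :=
    (Set.Subset.antisymm hsub Literature.Computability.Complexity.P_subset_NP_holds).symm
  -- Meyer–Stockmeyer collapse: P = NP ⟹ PH ⊆ P (induction on the level).
  have hNP : Literature.Computability.Complexity.polyExists Literature.Computability.Complexity.Classes.P =
      Literature.Computability.Complexity.Nondeterministic.NP := by
    have h1 : Literature.Computability.Complexity.SigmaP 1 =
        Literature.Computability.Complexity.Nondeterministic.NP :=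
      Literature.Computability.Complexity.SigmaP_one_holds
    rw [Literature.Computability.Complexity.SigmaP_succ, Literature.Computability.Complexity.PiP_eq_co,
      Literature.Computability.Complexity.SigmaP_zero,
      show Literature.Computability.Complexity.co Literature.Computability.Complexity.Classes.P =
        Literature.Computability.Complexity.Classes.P from Literature.Computability.Complexity.co_P_holds] at h1
    exact h1
  have hk : ∀ k : ℕ, Literature.Computability.Complexity.SigmaP k = Literature.Computability.Complexity.Classes.P := by
    intro k
    induction k with
    | zero => rfl
    | succ k ih =>
      rw [Literature.Computability.Complexity.SigmaP_succ, Literature.Computability.Complexity.PiP_eq_co, ih,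
        show Literature.Computability.Complexity.co Literature.Computability.Complexity.Classes.P =
          Literature.Computability.Complexity.Classes.P from Literature.Computability.Complexity.co_P_holds, hNP]
      exact heq.symm
  have hPH : Literature.Computability.Complexity.PH ⊆ Literature.Computability.Complexity.Classes.P := by
    intro L hL
    obtain ⟨k, hk'⟩ := Set.mem_iUnion.1 hL
    rwa [hk k] at hk'
  exact hA (hPH hB)

end Summit.PneNP.PneNP.Theses.StraightLineSign
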